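import Summits.AtomisticToContinuum.BoseEinsteinCondensation.Theorems.BECThomsonPrincipleGDTransferSeededDefs

/-!
# Route `BECThomsonPrinciple`, crux `GDTransfer` (stmt-AtomisticToContinuum-9482), line `seeded-continuity`:
# third Defs file — the rough-potential stub split at the null-modification class (lead c2, skeleton v5)

`Defs` file (D-0016) continuing `BECThomsonPrincipleGDTransferSeededDefs.lean` (p137609) and
`BECThomsonPrincipleGDTransferSeededWitnessDefs.lean` (p139431).  The registered stub
`stub_roughPotentials : GaussianDominationCan → NoBalancedCat → (soft conclusion) → ∀ v adm, ¬ IsFiniteContinuous v →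
PeriodicBECFor v` (everything outside the finite-continuous class) is reshaped (lead c2, skeleton v5) into two
registered stubs composed here sorry-free (`roughPotentials_of`):

* `stub_roughNull` [M, closable]: the periodic BEC statement `PeriodicBECFor` is invariant under modifications of the
  profile on a set whose radial lift `x ↦ v ‖x‖` is Lebesgue-null in `ℝ³` — the periodic energy sees `v` only through
  the a.e. class of `X ↦ Σ_{i<j} v^per(xᵢ − xⱼ)` on configuration space (each pair map `X ↦ xᵢ − xⱼ` is a shear of
  Haar measure, so it pulls null sets back to null sets), hence `periodicEnergy v = periodicEnergy w`,
  `E₀(v) = E₀(w)` and `PeriodicBECFor v ↔ PeriodicBECFor w`;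
* `stub_essentiallyRough` [crux-sized, open]: the ESSENTIALLY rough regime — admissible profiles that are NOT a.e. equal to
  an admissible finite continuous profile (hard cores `v = ⊤` on a set of positive measure, essential discontinuities,
  essentially unbounded profiles) — given GD, the seed and the soft conclusion.  This is where the hard ⇐ soft comparison
  problem lives (route `BECHardSphereComparison`'s theme); implied by the crux (`essentiallyRough_of_gdTransfer`).

Objects: `IsNullModificationOfSoft`; registered signatures `Sig.stub_roughNull`, `Sig.stub_essentiallyRough`; glue
`roughPotentials_of`; sanity `essentiallyRough_of_gdTransfer`, `isNullModificationOfSoft_of_isFiniteContinuous`.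
Nothing open is asserted: every `def … : Prop` is a statement consumed only as the type of a stub theorem or as an
explicit hypothesis.

References: LSSY2005 §1.2 (1.16) and Ch. 2 (2.1) (the admissible class: measurable, finite range, hard cores allowed);
Fournais2020 (1.1) (the periodic energy form).
-/

noncomputable section

open MeasureTheory
open scoped ENNReal

namespace Summit.AtomisticToContinuum.BoseEinsteinCondensation.Cruxes.GDTransfer.Seeded

open Literature.MathematicalPhysics.QuantumManyBody.BoseGas
open Summit.AtomisticToContinuum.BoseEinsteinCondensation.Theses.BECThomsonPrinciple
open Summit.AtomisticToContinuum.BoseEinsteinCondensation.Cruxes.GDTransfer.DysonDressedWitness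
  (PeriodicBECFor gdTransfer_iff)

/-! ## §0 Vocabulary -/

/-- `v` is a NULL MODIFICATION OF A SOFT PROFILE: some admissible finite continuous profile `w` has the same radial lift
`x ↦ w ‖x‖` as `v` Lebesgue-almost everywhere on `ℝ³` (e.g. a finite continuous profile changed on a Lebesgue-null set of
radii, or given hard-core values on a sphere `|x| = a`). -/
def IsNullModificationOfSoft (v : ℝ → ℝ≥0∞) : Prop :=
  ∃ w : ℝ → ℝ≥0∞, IsRepulsiveFiniteRange w ∧ IsFiniteContinuous w ∧ ∀ᵐ x : Space, v ‖x‖ = w ‖x‖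

/-! ## §1 Registered stub signatures (skeleton v5) -/

/-- Registered signature of `stub_roughNull` [M; closable: `periodicEnergy`, hence `periodicGroundStateEnergy` and
`PeriodicBECFor`, depend on the profile only through the a.e. class of its radial lift — shear invariance of Haar measure
on configuration space pair by pair, countably many lattice images]: a.e.-equal radial lifts have the same periodic BEC
statement. -/
def Sig.stub_roughNull : Prop :=
  ∀ v w : ℝ → ℝ≥0∞, IsRepulsiveFiniteRange v → IsRepulsiveFiniteRange w →
    (∀ᵐ x : Space, v ‖x‖ = w ‖x‖) → PeriodicBECFor w → PeriodicBECFor v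

/-- Registered signature of `stub_essentiallyRough` [crux-sized; the essentially rough regime — hard cores on a set of
positive measure, essential discontinuities, essentially unbounded profiles — given GD, the seed and the soft conclusion;
inherited GD for `v ∧ n` at fixed `(N, L)`, Dyson-dressed projected witnesses, Mosco continuity in `L`, or a hard ⇐ soft
comparison theorem; implied by the crux (`essentiallyRough_of_gdTransfer`)]. -/
def Sig.stub_essentiallyRough : Prop :=
  GaussianDominationCan → NoBalancedCat →
    (∀ v : ℝ → ℝ≥0∞, IsRepulsiveFiniteRange v → IsFiniteContinuous v → PeriodicBECFor v) →
    ∀ v : ℝ → ℝ≥0∞, IsRepulsiveFiniteRange v → ¬ IsNullModificationOfSoft v → PeriodicBECFor v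

/-! ## §2 Glue (sorry-free) -/

/-- **The two v5 stubs give the registered v2 stub `stub_roughPotentials`**: a rough profile is either a null
modification of a soft one (then it inherits the soft conclusion through `stub_roughNull`) or essentially rough. -/
theorem roughPotentials_of : Summit.AtomisticToContinuum.BoseEinsteinCondensation.Cruxes.GDTransfer.Seeded.Sig.stub_roughNull → Summit.AtomisticToContinuum.BoseEinsteinCondensation.Cruxes.GDTransfer.Seeded.Sig.stub_essentiallyRough → Summit.AtomisticToContinuum.BoseEinsteinCondensation.Cruxes.GDTransfer.Seeded.Sig.stub_roughPotentials := by
  intro hNull hEss hG hSeed hsoft v hv _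
  by_cases h : IsNullModificationOfSoft v
  · obtain ⟨w, hw, hwfc, hae⟩ := h
    exact hNull v w hv hw hae (hsoft w hw hwfc)
  · exact hEss hG hSeed hsoft v hv h

/-! ## §3 Sanity (sorry-free) -/

/-- The essentially rough stub is a weakening of the crux (implied by it). -/
theorem essentiallyRough_of_gdTransfer (h : GDTransfer) : Sig.stub_essentiallyRough :=
  fun hG _ _ v hv _ => (gdTransfer_iff.mp h) hG v hv

/-- A finite continuous admissible profile is (trivially) a null modification of a soft profile, so
`stub_essentiallyRough` only ever meets profiles outside the finite-continuous class. -/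
theorem isNullModificationOfSoft_of_isFiniteContinuous {v : ℝ → ℝ≥0∞} (hv : IsRepulsiveFiniteRange v)
    (hfc : IsFiniteContinuous v) : IsNullModificationOfSoft v :=
  ⟨v, hv, hfc, Filter.Eventually.of_forall fun _ => rfl⟩

end Summit.AtomisticToContinuum.BoseEinsteinCondensation.Cruxes.GDTransfer.Seeded

end
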